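import Summits.FinalStateConjecture.FinalStateConjecture.Theorems.EIHFluxBalanceModulatedKerrHandoffTameDefs
import Literature.Geometry.Lorentzian.TameGenericity
import HarnessLib

/-!
# Births (BC3-style skeletons per PIECE) for the strategist line `trim_kick_censorship` of the crux
# `EIHFluxBalance.ModulatedKerrHandoff` (item stmt-FinalStateConjecture-17402)

For each of the three pieces of the split (`TameEndTrimming`, `KickCensorship`, `CensoredKickHandoff`,
texts = the route-children statements filed in `split-children.json`), ≥ 2 named stubs and a PROVED
composition `<Piece>_of`. Sorries only inside `stub_*`.

* `TameEndTrimming_of` ⇐ `stub_gluingWithTailControl` (the gluing theorem in its natural QUANTITATIVE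
  form: corrections and mass shift bounded by a constant times the Dafermos–Rodnianski TAIL MODULUS
  `Θ(R/2)` of `d` beyond half the radius) ⊕ `stub_tailModulus_tendsto_zero` (the tail modulus of a
  DR-flat datum tends to `0` — provable now: it is the `o₂(r⁻¹) / o₁(r⁻²)` condition read as a sup).
* `KickCensorship_of` ⇐ `stub_lateKickCensorship` (censorship restored by late local kicks on a pinned
  co-slice — the censorship conjunct of LateLocalKicks.LateKick, 17990) ⊕ `stub_kickTransport` (= item
  11696 `KickTransport` verbatim) ⊕ `stub_censorshipSliceIndependence` (the censorship conjunct of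
  `SliceIndependence`, 17991) ⊕ `stub_mghdExists` (= item 9937 verbatim).
* `CensoredKickHandoff_of` ⇐ `stub_pointwiseCensoredKickHandoff` (per-parameter trimming thresholds)
  ⊕ `stub_thresholdLocallyBounded` (local UNIFORMITY of the thresholds along the kick family —
  continuity of settling under Cauchy-stable perturbations; the "bad c pile up" issue made a statement).
-/

set_option linter.dupNamespace false
set_option linter.unusedVariables false

noncomputable section

namespace Summit.FinalStateConjecture.FinalStateConjecture.Cruxes.ModulatedKerrHandoff.TrimKickCensorship.Births

open scoped Topology Manifold ContDiff ENNReal NNReal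
open Filter Set Function TopologicalSpace Literature.Geometry.Lorentzian InitialDataSet
open Summit.FinalStateConjecture.FinalStateConjecture.Theorems.EIHFluxBalance.TameTemplate

/-! ## The three pieces (route-children texts) -/

/-- Piece T. -/
def TameEndTrimming : Prop :=
  ∀ (X : Type) [TopologicalSpace X] [ChartedSpace E3 X] [IsManifold (𝓡 3) ((⊤ : ℕ∞) : WithTop ℕ∞) X] [T2Space X] [SecondCountableTopology X] [ConnectedSpace X], ∀ d ∈ admissibleVacuumData X, ∀ (e : AFEnd X) (M₀ : ℝ), e.IsSoleEnd → e.IsStronglyAsymptoticallyFlatDR d M₀ → ∃ (R₀ : ℝ) (T : ℝ → InitialDataSet (𝓡 3) X) (M : ℝ → ℝ), ((∀ R, R₀ ≤ R → T R ∈ admissibleVacuumData X ∧ (∃ Mt : ℝ, e.IsStronglyAsymptoticallyFlatWith (T R) Mt (15 / 8) (23 / 8) 4 3) ∧ e.IsStronglyAsymptoticallyFlatDR (T R) (M R) ∧ ∀ x ∉ e.far R, (T R).h.inner x = d.h.inner x ∧ (T R).k x = d.k x) ∧ (∀ ρ : EuclideanSpace ℝ (Fin 1) → ℝ, ContDiff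 ℝ ((⊤ : ℕ∞) : WithTop ℕ∞) ρ → (∀ c, R₀ ≤ ρ c) → InitialDataSet.IsSmoothDataFamily 1 (fun c ↦ T (ρ c))) ∧ ContinuousOn M (Set.Ici R₀) ∧ Tendsto M atTop (𝓝 M₀) ∧ Tendsto (fun R ↦ e.wDist (T R) d) atTop (𝓝 0))

/-- Piece W. -/
def KickCensorship : Prop :=
  ∀ (X : Type) [TopologicalSpace X] [ChartedSpace E3 X] [IsManifold (𝓡 3) ((⊤ : ℕ∞) : WithTop ℕ∞) X] [T2Space X] [SecondCountableTopology X] [ConnectedSpace X], ∀ d ∈ admissibleVacuumData X, (¬ ∀ 𝒟 : VacuumCauchyDevelopment d, 𝒟.IsMaximal → Summit.FinalStateConjecture.HasCompleteNullInfinity 𝒟.toCauchyDevelopment) → ∃ G : EuclideanSpace ℝ (Fin 1) → InitialDataSet (𝓡 3) X, (InitialDataSet.IsSmoothDataFamily 1 G ∧ G 0 = d ∧ (∀ c, G c ∈ admissibleVacuumData X) ∧ ∃ K : Set X, IsCompact K ∧ ∀ c, ∀ x ∉ K, (G c).h.inner x = d.h.inner x ∧ (G c).k x = d.k x) ∧ ∃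 δ : ℝ, 0 < δ ∧ ∀ c : EuclideanSpace ℝ (Fin 1), 0 < c 0 → c 0 < δ → ∀ 𝒟 : VacuumCauchyDevelopment (G c), 𝒟.IsMaximal → Summit.FinalStateConjecture.HasCompleteNullInfinity 𝒟.toCauchyDevelopment

/-- Piece K. -/
def CensoredKickHandoff : Prop :=
  ∀ (X : Type) [TopologicalSpace X] [ChartedSpace E3 X] [IsManifold (𝓡 3) ((⊤ : ℕ∞) : WithTop ℕ∞) X] [T2Space X] [SecondCountableTopology X] [ConnectedSpace X], ∀ d ∈ admissibleVacuumData X, ¬ Summit.FinalStateConjecture.FinalStateConjecture.Theorems.EIHFluxBalance.TameTemplate.HandoffPropT X d → ∀ (G₁ : EuclideanSpace ℝ (Fin 1) → InitialDataSet (𝓡 3) X) (δ₁ : ℝ), (InitialDataSet.IsSmoothDataFamily 1 G₁ ∧ G₁ 0 = d ∧ (∀ c, G₁ c ∈ admissibleVacuumData X) ∧ ∃ K : Set X, IsCompact K ∧ ∀ c, ∀ x ∉ K, (G₁ c).h.inner x = d.h.inner x ∧ (G₁ c).k x = d.k x) → 0 < δ₁ → (∀ c : EuclideanSpace ℝ (Fin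 1), 0 < c 0 → c 0 < δ₁ → ∀ 𝒟 : VacuumCauchyDevelopment (G₁ c), 𝒟.IsMaximal → Summit.FinalStateConjecture.HasCompleteNullInfinity 𝒟.toCauchyDevelopment) → ∀ (e : AFEnd X) (M₀ R₀ : ℝ) (T : ℝ → InitialDataSet (𝓡 3) X) (M : ℝ → ℝ), e.IsSoleEnd → e.IsStronglyAsymptoticallyFlatDR d M₀ → ((∀ R, R₀ ≤ R → T R ∈ admissibleVacuumData X ∧ (∃ Mt : ℝ, e.IsStronglyAsymptoticallyFlatWith (T R) Mt (15 / 8) (23 / 8) 4 3) ∧ e.IsStronglyAsymptoticallyFlatDR (T R) (M R) ∧ ∀ x ∉ e.far R, (T R).h.inner x = d.h.inner x ∧ (T R).k x = d.k x) ∧ (∀ ρ : EuclideanSpace ℝ (Fin 1) → ℝ, ContDiff ℝ ((⊤ : ℕ∞) : WithTop ℕ∞) ρ → (∀ c, R₀ ≤ ρ c) → InitialDataSet.IsSmoothDataFamily 1 (fun c ↦ T (ρ c))) ∧ ContinuousOn M (Set.Ici R₀) ∧ Tendsto M atTop (𝓝 M₀) ∧ Tendsto (fun R ↦ e.wDist (T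 R) d) atTop (𝓝 0)) → ∃ G : EuclideanSpace ℝ (Fin 1) → InitialDataSet (𝓡 3) X, (InitialDataSet.IsSmoothDataFamily 1 G ∧ G 0 = d ∧ (∀ c, G c ∈ admissibleVacuumData X) ∧ ∃ K : Set X, IsCompact K ∧ ∀ c, ∀ x ∉ K, (G c).h.inner x = d.h.inner x ∧ (G c).k x = d.k x) ∧ ∃ (δ : ℝ) (ρ₁ : ℝ → ℝ), 0 < δ ∧ (∀ a b : ℝ, 0 < a → a ≤ b → b < δ → BddAbove (ρ₁ '' Set.Icc a b)) ∧ ∀ c : EuclideanSpace ℝ (Fin 1), 0 < c 0 → c 0 < δ → ∀ R : ℝ, R₀ ≤ R → ρ₁ (c 0) ≤ R → ∀ D' ∈ admissibleVacuumData X, (∀ x ∉ e.far R, D'.h.inner x = (G c).h.inner x ∧ D'.k x = (G c).k x) → (∀ x ∈ e.far R, D'.h.inner x = (T R).h.inner x ∧ D'.k x = (T R).k x) → ∃ 𝒟 : VacuumCauchyDevelopment D', 𝒟.IsMaximal ∧ Summit.FinalStateConjecture.FinalStateConjecture.Theorems.EIHFluxBalance.TameTemplate.HandoffClause X D' 𝒟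

/-! ## Birth of `TameEndTrimming` -/

/-- STUB T1 — parametric end gluing with TAIL CONTROL (Corvino–Schoen / Chruściel–Delay with solution
operators; the weighted correction and the mass shift are `≤ C · Θ(R/2)`). [cite: CorvinoSchoen2006, Thm 1] -/
theorem stub_gluingWithTailControl :
    ∀ (X : Type) [TopologicalSpace X] [ChartedSpace E3 X] [IsManifold (𝓡 3) ((⊤ : ℕ∞) : WithTop ℕ∞) X] [T2Space X] [SecondCountableTopology X] [ConnectedSpace X], ∀ d ∈ admissibleVacuumData X, ∀ (e : AFEnd X) (M₀ : ℝ), e.IsSoleEnd → e.IsStronglyAsymptoticallyFlatDR d M₀ → let Θ : ℝ → ENNReal := (fun R : ℝ ↦ (⨆ (m : ℕ) (_ : m ≤ 2) (x : E3) (_ : R < ‖x‖), ENNReal.ofReal (‖x‖ ^ (1 + m)) * ‖iteratedFDeriv ℝ m (fun y ↦ e.hCoeff d y - (1 + 2 * M₀ / ‖y‖) • (innerSL ℝ : E3 →L[ℝ] E3 →L[ℝ] ℝ)) x‖ₑ) + ⨆ (m : ℕ) (_ : m ≤ 1) (x : E3) (_ : R < ‖x‖), ENNReal.ofReal (‖x‖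 ^ (2 + m)) * ‖iteratedFDeriv ℝ m (e.kCoeff d) x‖ₑ); ∃ (R₀ : ℝ) (T : ℝ → InitialDataSet (𝓡 3) X) (M : ℝ → ℝ) (C : NNReal), 0 < R₀ ∧ (∀ R, R₀ ≤ R → T R ∈ admissibleVacuumData X ∧ (∃ Mt : ℝ, e.IsStronglyAsymptoticallyFlatWith (T R) Mt (15 / 8) (23 / 8) 4 3) ∧ e.IsStronglyAsymptoticallyFlatDR (T R) (M R) ∧ (∀ x ∉ e.far R, (T R).h.inner x = d.h.inner x ∧ (T R).k x = d.k x) ∧ e.wDist (T R) d ≤ C * Θ (R / 2) ∧ ENNReal.ofReal |M R - M₀| ≤ C * Θ (R / 2)) ∧ (∀ ρ : EuclideanSpace ℝ (Fin 1) → ℝ, ContDiff ℝ ((⊤ : ℕ∞) : WithTop ℕ∞) ρ → (∀ c, R₀ ≤ ρ c) → InitialDataSet.IsSmoothDataFamily 1 (fun c ↦ T (ρ c))) ∧ ContinuousOn M (Set.Ici R₀) := by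
  sorry

/-- STUB T2 — the Dafermos–Rodnianski tail modulus of a DR-flat datum tends to zero (provable now:
little-o along `cobounded` read as a weighted sup beyond `R`). [cite: DafermosRodnianski2013, App. B.2.3] -/
theorem stub_tailModulus_tendsto_zero :
    ∀ (X : Type) [TopologicalSpace X] [ChartedSpace E3 X] [IsManifold (𝓡 3) ((⊤ : ℕ∞) : WithTop ℕ∞) X] [T2Space X] [SecondCountableTopology X] [ConnectedSpace X], ∀ (d : InitialDataSet (𝓡 3) X) (e : AFEnd X) (M₀ : ℝ), e.IsStronglyAsymptoticallyFlatDR d M₀ → Tendsto (fun R : ℝ ↦ (⨆ (m : ℕ) (_ : m ≤ 2) (x : E3) (_ : R < ‖x‖), ENNReal.ofReal (‖x‖ ^ (1 + m)) * ‖iteratedFDeriv ℝ m (fun y ↦ e.hCoeff d y - (1 + 2 * M₀ / ‖y‖) • (innerSL ℝ : E3 →L[ℝ] E3 →L[ℝ] ℝ)) x‖ₑ) + ⨆ (m : ℕ) (_ : m ≤ 1) (x : E3) (_ : R < ‖x‖), ENNReal.ofReal (‖x‖ ^ (2 + m)) * ‖iteratedFDeriv ℝ m (e.kCoeff d) x‖ₑ)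 atTop (𝓝 0) := by
  sorry

/-- COMPOSITION: `TameEndTrimming` from T1 ⊕ T2 (squeeze `wDist ≤ C Θ(R/2) → 0`, and
`|M R − M₀| ≤ (C Θ(R/2)).toReal → 0`). -/
theorem TameEndTrimming_of : TameEndTrimming := by
  intro X _ _ _ _ _ _ d hd e M₀ hsole hDR
  obtain ⟨R₀, T, M, C, hR₀, hspec, hsmooth, hMcont⟩ := stub_gluingWithTailControl X d hd e M₀ hsole hDR
  have hΘ := stub_tailModulus_tendsto_zero X d e M₀ hDR
  -- `Θ (R/2) → 0` along `atTop`
  have hhalf : Tendsto (fun R : ℝ ↦ R / 2) atTop atTop :=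
    Filter.tendsto_id.atTop_div_const (by norm_num)
  have hΘ2 := hΘ.comp hhalf
  have hCΘ : Tendsto (fun R : ℝ ↦ (C : ℝ≥0∞) * (fun R : ℝ ↦ (⨆ (m : ℕ) (_ : m ≤ 2) (x : E3) (_ : R < ‖x‖), ENNReal.ofReal (‖x‖ ^ (1 + m)) * ‖iteratedFDeriv ℝ m (fun y ↦ e.hCoeff d y - (1 + 2 * M₀ / ‖y‖) • (innerSL ℝ : E3 →L[ℝ] E3 →L[ℝ] ℝ)) x‖ₑ) + ⨆ (m : ℕ) (_ : m ≤ 1) (x : E3) (_ : R < ‖x‖), ENNReal.ofReal (‖x‖ ^ (2 + m)) * ‖iteratedFDeriv ℝ m (e.kCoeff d) x‖ₑ) (R / 2)) atTop (𝓝 0) := by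
    have h := ENNReal.Tendsto.const_mul (a := (C : ℝ≥0∞)) hΘ2 (Or.inr ENNReal.coe_ne_top)
    simpa only [mul_zero, Function.comp_def] using h
  refine ⟨R₀, T, M, fun R hR ↦ ⟨(hspec R hR).1, (hspec R hR).2.1, (hspec R hR).2.2.1,
    (hspec R hR).2.2.2.1⟩, hsmooth, hMcont, ?_, ?_⟩
  · -- mass
    have hb : ∀ᶠ R in atTop, ENNReal.ofReal |M R - M₀| ≤ (C : ℝ≥0∞) * (fun R : ℝ ↦ (⨆ (m : ℕ) (_ : m ≤ 2) (x : E3) (_ : R < ‖x‖), ENNReal.ofReal (‖x‖ ^ (1 + m)) * ‖iteratedFDeriv ℝ m (fun y ↦ e.hCoeff d y - (1 + 2 * M₀ / ‖y‖) • (innerSL ℝ : E3 →L[ℝ] E3 →L[ℝ] ℝ)) x‖ₑ) + ⨆ (m : ℕ) (_ : m ≤ 1) (x : E3) (_ : R < ‖x‖), ENNReal.ofReal (‖x‖ ^ (2 + m)) * ‖iteratedFDeriv ℝ m (e.kCoeff d) x‖ₑ) (R / 2) :=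
      (eventually_ge_atTop R₀).mono fun R hR ↦ (hspec R hR).2.2.2.2.2
    have h1 : Tendsto (fun R ↦ ENNReal.ofReal |M R - M₀|) atTop (𝓝 0) :=
      tendsto_of_tendsto_of_tendsto_of_le_of_le' tendsto_const_nhds hCΘ
        (Eventually.of_forall fun R ↦ bot_le) hb
    have h2 : Tendsto (fun R ↦ |M R - M₀|) atTop (𝓝 0) := by
      have h3 := (ENNReal.tendsto_toReal ENNReal.zero_ne_top).comp h1
      simpa only [Function.comp_def, ENNReal.toReal_ofReal (abs_nonneg _), ENNReal.toReal_zero]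
        using h3
    have h4 : Tendsto (fun R ↦ M R - M₀) atTop (𝓝 0) :=
      (tendsto_zero_iff_abs_tendsto_zero _).2 h2
    have h5 := h4.add_const M₀
    simpa only [sub_add_cancel, zero_add] using h5
  · -- tameness
    have hb : ∀ᶠ R in atTop, e.wDist (T R) d ≤ (C : ℝ≥0∞) * (fun R : ℝ ↦ (⨆ (m : ℕ) (_ : m ≤ 2) (x : E3) (_ : R < ‖x‖), ENNReal.ofReal (‖x‖ ^ (1 + m)) * ‖iteratedFDeriv ℝ m (fun y ↦ e.hCoeff d y - (1 + 2 * M₀ / ‖y‖) • (innerSL ℝ : E3 →L[ℝ] E3 →L[ℝ] ℝ)) x‖ₑ) + ⨆ (m : ℕ) (_ : m ≤ 1) (x : E3) (_ : R < ‖x‖), ENNReal.ofReal (‖x‖ ^ (2 + m)) * ‖iteratedFDeriv ℝ m (e.kCoeff d) x‖ₑ) (R / 2) :=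
      (eventually_ge_atTop R₀).mono fun R hR ↦ (hspec R hR).2.2.2.2.1
    exact tendsto_of_tendsto_of_tendsto_of_le_of_le' tendsto_const_nhds hCΘ
      (Eventually.of_forall fun R ↦ bot_le) hb

/-! ## Birth of `KickCensorship` -/

/-- STUB W1 — censorship restored by LATE local kicks on a pinned co-slice (the censorship conjunct of
LateLocalKicks.LateKick, item 17990). [cite: Christodoulou1999, p. A24] -/
theorem stub_lateKickCensorship :
    ∀ (X : Type) [TopologicalSpace X] [ChartedSpace E3 X] [IsManifold (𝓡 3) ((⊤ : ℕ∞) : WithTop ℕ∞) X] [T2Space X] [SecondCountableTopology X] [ConnectedSpace X], ∀ d ∈ admissibleVacuumData X, let Cens : InitialDataSet (𝓡 3) X → Prop := fun D ↦ ∀ 𝒟 : VacuumCauchyDevelopment D, 𝒟.IsMaximal → Summit.FinalStateConjecture.HasCompleteNullInfinity 𝒟.toCauchyDevelopment; let Local : InitialDataSet (𝓡 3) X → (EuclideanSpace ℝ (Fin 1) → InitialDataSet (𝓡 3) X) → Prop := fun D G ↦ InitialDataSet.IsSmoothDataFamily 1 G ∧ G 0 = D ∧ (∀ c, G c ∈ admissibleVacuumData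 X) ∧ ∃ K : Set X, IsCompact K ∧ ∀ c, ∀ x ∉ K, (G c).h.inner x = D.h.inner x ∧ (G c).k x = D.k x; let CoSlice : InitialDataSet (𝓡 3) X → InitialDataSet (𝓡 3) X → Prop := fun D D' ↦ ∃ (𝒟 : VacuumCauchyDevelopment D) (𝒟' : VacuumCauchyDevelopment D') (ψ : 𝒟'.carrier → 𝒟.carrier), ContMDiff (𝓡 4) (𝓡 4) ((⊤ : ℕ∞) : WithTop ℕ∞) ψ ∧ Topology.IsOpenEmbedding ψ ∧ 𝒟'.metric.IsIsometricImmersion 𝒟.metric.toPseudoRiemannianMetric ψ ∧ 𝒟'.timeOrientation.PreservesTimeOrientation ψ 𝒟.timeOrientation ∧ 𝒟.metric.IsCauchyHypersurface 𝒟.timeOrientation (Set.range (ψ ∘ 𝒟'.embed)) ∧ ∃ C : Set X, IsCompact C ∧ ∀ x ∉ C, ψ (𝒟'.embed x) = 𝒟.embed x; ¬ Cens d → ∃ d' ∈ admissibleVacuumData X, CoSlice d d' ∧ ∃ G' : EuclideanSpace ℝ (Fin 1) → InitialDataSet (𝓡 3) X, Local d' G' ∧ ∃ δ : ℝ, 0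 < δ ∧ ∀ c : EuclideanSpace ℝ (Fin 1), 0 < c 0 → c 0 < δ → Cens (G' c) := by
  sorry

/-- STUB W2 — Cauchy-stability transport of local kicks along pinned co-slices (= item 11696
`LateLocalKicks.KickTransport` verbatim; known theorem, XL formalisation). [cite: HawkingEllis1973, §7.6] -/
theorem stub_kickTransport :
    ∀ (X : Type) [TopologicalSpace X] [ChartedSpace E3 X] [IsManifold (𝓡 3) ((⊤ : ℕ∞) : WithTop ℕ∞) X] [T2Space X] [SecondCountableTopology X] [ConnectedSpace X], ∀ d ∈ admissibleVacuumData X, ∀ d' ∈ admissibleVacuumData X, let Cens : InitialDataSet (𝓡 3) X → Prop := fun D ↦ ∀ 𝒟 : VacuumCauchyDevelopment D, 𝒟.IsMaximal → Summit.FinalStateConjecture.HasCompleteNullInfinity 𝒟.toCauchyDevelopment; let Local : InitialDataSet (𝓡 3) X → (EuclideanSpace ℝ (Fin 1) → InitialDataSet (𝓡 3) X) → Prop := fun D G ↦ InitialDataSet.IsSmoothDataFamily 1 G ∧ G 0 = D ∧ (∀ c, G c ∈ admissibleVacuumData X) ∧ ∃ K : Set X, IsCompact K ∧ ∀ c, ∀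 x ∉ K, (G c).h.inner x = D.h.inner x ∧ (G c).k x = D.k x; let CoSlice : InitialDataSet (𝓡 3) X → InitialDataSet (𝓡 3) X → Prop := fun D D' ↦ ∃ (𝒟 : VacuumCauchyDevelopment D) (𝒟' : VacuumCauchyDevelopment D') (ψ : 𝒟'.carrier → 𝒟.carrier), ContMDiff (𝓡 4) (𝓡 4) ((⊤ : ℕ∞) : WithTop ℕ∞) ψ ∧ Topology.IsOpenEmbedding ψ ∧ 𝒟'.metric.IsIsometricImmersion 𝒟.metric.toPseudoRiemannianMetric ψ ∧ 𝒟'.timeOrientation.PreservesTimeOrientation ψ 𝒟.timeOrientation ∧ 𝒟.metric.IsCauchyHypersurface 𝒟.timeOrientation (Set.range (ψ ∘ 𝒟'.embed)) ∧ ∃ C : Set X, IsCompact C ∧ ∀ x ∉ C, ψ (𝒟'.embed x) = 𝒟.embed x; CoSlice d d' → ∀ G' : EuclideanSpace ℝ (Fin 1) → InitialDataSet (𝓡 3) X, Local d' G' → ∃ G : EuclideanSpace ℝ (Fin 1) → InitialDataSet (𝓡 3) X, Local d G ∧ ∃ δ : ℝ, 0 < δ ∧ ∀ c : EuclideanSpace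 ℝ (Fin 1), |c 0| < δ → CoSlice (G c) (G' c) := by
  sorry

/-- STUB W3 — censorship is slice independent along pinned co-slices (the censorship conjunct of item
17991 `LateLocalKicks.SliceIndependence`). [cite: Christodoulou1999, pp. A26–A27] -/
theorem stub_censorshipSliceIndependence :
    ∀ (X : Type) [TopologicalSpace X] [ChartedSpace E3 X] [IsManifold (𝓡 3) ((⊤ : ℕ∞) : WithTop ℕ∞) X] [T2Space X] [SecondCountableTopology X] [ConnectedSpace X], ∀ d ∈ admissibleVacuumData X, ∀ d' ∈ admissibleVacuumData X, let Cens : InitialDataSet (𝓡 3) X → Prop := fun D ↦ ∀ 𝒟 : VacuumCauchyDevelopment D, 𝒟.IsMaximal → Summit.FinalStateConjecture.HasCompleteNullInfinity 𝒟.toCauchyDevelopment; let Local : InitialDataSet (𝓡 3) X → (EuclideanSpace ℝ (Fin 1) → InitialDataSet (𝓡 3) X) → Prop := fun D G ↦ InitialDataSet.IsSmoothDataFamily 1 G ∧ G 0 = D ∧ (∀ c, G c ∈ admissibleVacuumData X) ∧ ∃ K : Set X, IsCompact K ∧ ∀ c, ∀ x ∉ K, (G c).h.inner x = D.h.inner x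 ∧ (G c).k x = D.k x; let CoSlice : InitialDataSet (𝓡 3) X → InitialDataSet (𝓡 3) X → Prop := fun D D' ↦ ∃ (𝒟 : VacuumCauchyDevelopment D) (𝒟' : VacuumCauchyDevelopment D') (ψ : 𝒟'.carrier → 𝒟.carrier), ContMDiff (𝓡 4) (𝓡 4) ((⊤ : ℕ∞) : WithTop ℕ∞) ψ ∧ Topology.IsOpenEmbedding ψ ∧ 𝒟'.metric.IsIsometricImmersion 𝒟.metric.toPseudoRiemannianMetric ψ ∧ 𝒟'.timeOrientation.PreservesTimeOrientation ψ 𝒟.timeOrientation ∧ 𝒟.metric.IsCauchyHypersurface 𝒟.timeOrientation (Set.range (ψ ∘ 𝒟'.embed)) ∧ ∃ C : Set X, IsCompact C ∧ ∀ x ∉ C, ψ (𝒟'.embed x) = 𝒟.embed x; CoSlice d d' → (∃ 𝒟' : VacuumCauchyDevelopment d', 𝒟'.IsMaximal) → Cens d' → Cens d := by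
  sorry

/-- STUB W4 — every admissible datum has an MGHD (= item 9937 `MGHDExists` verbatim; Choquet-Bruhat–Geroch).
[cite: ChoquetBruhatGeroch1969CMP, Thm 3] -/
theorem stub_mghdExists :
    ∀ (X : Type) [TopologicalSpace X] [ChartedSpace E3 X] [IsManifold (𝓡 3) ((⊤ : ℕ∞) : WithTop ℕ∞) X] [T2Space X] [SecondCountableTopology X] [ConnectedSpace X], ∀ D ∈ admissibleVacuumData X, ∃ 𝒟 : VacuumCauchyDevelopment D, 𝒟.IsMaximal := by
  sorry

/-- COMPOSITION: `KickCensorship` from W1 ⊕ W2 ⊕ W3 ⊕ W4 (kick late, transport the kick family to the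
initial slice, transfer censorship member by member). -/
theorem KickCensorship_of : KickCensorship := by
  intro X _ _ _ _ _ _ d hd hnot
  obtain ⟨d', hd', hco, G', hG', δ', hδ', hcens'⟩ := stub_lateKickCensorship X d hd hnot
  obtain ⟨G, hG, δ, hδ, hcoG⟩ := stub_kickTransport X d hd d' hd' hco G' hG'
  refine ⟨G, hG, min δ δ', lt_min hδ hδ', fun c hc hcδ ↦ ?_⟩
  have hc1 : |c 0| < δ := by
    rw [abs_of_pos hc]
    exact hcδ.trans_le (min_le_left _ _)
  have hc2 : c 0 < δ' := hcδ.trans_le (min_le_right _ _)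
  exact stub_censorshipSliceIndependence X (G c) (hG.2.2.1 c) (G' c) (hG'.2.2.1 c) (hcoG c hc1)
    (stub_mghdExists X (G' c) (hG'.2.2.1 c)) (hcens' c hc hc2)

/-! ## Birth of `CensoredKickHandoff` -/

/-- STUB K1 — censored-kick handoff with PER-PARAMETER trimming thresholds (the capture content).
[cite: DafermosLuk2017, Conjecture 1] -/
theorem stub_pointwiseCensoredKickHandoff :
    open Literature.Geometry.Lorentzian in ∀ (X : Type) [TopologicalSpace X] [ChartedSpace E3 X] [IsManifold (𝓡 3) ((⊤ : ℕ∞) : WithTop ℕ∞) X] [T2Space X] [SecondCountableTopology X] [ConnectedSpace X], ∀ d ∈ admissibleVacuumData X, ¬ Summit.FinalStateConjecture.FinalStateConjecture.Theorems.EIHFluxBalance.TameTemplate.HandoffPropT X d → ∀ (G₁ : EuclideanSpace ℝ (Fin 1) → InitialDataSet (𝓡 3) X) (δ₁ : ℝ), (InitialDataSet.IsSmoothDataFamily 1 G₁ ∧ G₁ 0 = d ∧ (∀ c, G₁ c ∈ admissibleVacuumData X) ∧ ∃ K : Set X, IsCompact K ∧ ∀ c, ∀ x ∉ K, (G₁ c).h.inner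 x = d.h.inner x ∧ (G₁ c).k x = d.k x) → 0 < δ₁ → (∀ c : EuclideanSpace ℝ (Fin 1), 0 < c 0 → c 0 < δ₁ → ∀ 𝒟 : VacuumCauchyDevelopment (G₁ c), 𝒟.IsMaximal → Summit.FinalStateConjecture.HasCompleteNullInfinity 𝒟.toCauchyDevelopment) → ∀ (e : AFEnd X) (M₀ R₀ : ℝ) (T : ℝ → InitialDataSet (𝓡 3) X) (M : ℝ → ℝ), e.IsSoleEnd → e.IsStronglyAsymptoticallyFlatDR d M₀ → ((∀ R, R₀ ≤ R → T R ∈ admissibleVacuumData X ∧ (∃ Mt : ℝ, e.IsStronglyAsymptoticallyFlatWith (T R) Mt (15 / 8) (23 / 8) 4 3) ∧ e.IsStronglyAsymptoticallyFlatDR (T R) (M R) ∧ ∀ x ∉ e.far R, (T R).h.inner x = d.h.inner x ∧ (T R).k x = d.k x) ∧ (∀ ρ : EuclideanSpace ℝ (Fin 1) → ℝ, ContDiff ℝ ((⊤ : ℕ∞) : WithTop ℕ∞) ρ → (∀ c, R₀ ≤ ρ c) → InitialDataSet.IsSmoothDataFamily 1 (fun c ↦ T (ρ c))) ∧ ContinuousOn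 M (Set.Ici R₀) ∧ Tendsto M atTop (𝓝 M₀) ∧ Tendsto (fun R ↦ e.wDist (T R) d) atTop (𝓝 0)) → ∃ G : EuclideanSpace ℝ (Fin 1) → InitialDataSet (𝓡 3) X, (InitialDataSet.IsSmoothDataFamily 1 G ∧ G 0 = d ∧ (∀ c, G c ∈ admissibleVacuumData X) ∧ ∃ K : Set X, IsCompact K ∧ ∀ c, ∀ x ∉ K, (G c).h.inner x = d.h.inner x ∧ (G c).k x = d.k x) ∧ ∃ δ : ℝ, 0 < δ ∧ ∀ c : EuclideanSpace ℝ (Fin 1), 0 < c 0 → c 0 < δ → ∃ R₁ : ℝ, ∀ R : ℝ, R₀ ≤ R → R₁ ≤ R → ∀ D' ∈ admissibleVacuumData X, (∀ x ∉ e.far R, D'.h.inner x = (G c).h.inner x ∧ D'.k x = (G c).k x) → (∀ x ∈ e.far R, D'.h.inner x = (T R).h.inner x ∧ D'.k x = (T R).k x) → ∃ 𝒟 : VacuumCauchyDevelopment D', 𝒟.IsMaximal ∧ Summit.FinalStateConjecture.FinalStateConjecture.Theorems.EIHFluxBalance.TameTemplate.HandoffClause X D' 𝒟 := by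
  sorry

/-- STUB K2 — the trimming thresholds along a kick family can be chosen LOCALLY BOUNDED on `(0, δ)`
(continuity of settling thresholds under Cauchy-stable perturbations). [cite: HawkingEllis1973, §7.6] -/
theorem stub_thresholdLocallyBounded :
    open Literature.Geometry.Lorentzian in ∀ (X : Type) [TopologicalSpace X] [ChartedSpace E3 X] [IsManifold (𝓡 3) ((⊤ : ℕ∞) : WithTop ℕ∞) X] [T2Space X] [SecondCountableTopology X] [ConnectedSpace X], ∀ d ∈ admissibleVacuumData X, ∀ (e : AFEnd X) (M₀ R₀ : ℝ) (T : ℝ → InitialDataSet (𝓡 3) X) (M : ℝ → ℝ), e.IsSoleEnd → e.IsStronglyAsymptoticallyFlatDR d M₀ → ((∀ R, R₀ ≤ R → T R ∈ admissibleVacuumData X ∧ (∃ Mt : ℝ, e.IsStronglyAsymptoticallyFlatWith (T R) Mt (15 / 8) (23 / 8) 4 3) ∧ e.IsStronglyAsymptoticallyFlatDR (T R) (M R) ∧ ∀ x ∉ e.far R, (T R).h.inner x = d.h.inner x ∧ (T R).k x = d.k x) ∧ (∀ ρ : EuclideanSpace ℝ (Fin 1) → ℝ, ContDiff ℝ ((⊤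 : ℕ∞) : WithTop ℕ∞) ρ → (∀ c, R₀ ≤ ρ c) → InitialDataSet.IsSmoothDataFamily 1 (fun c ↦ T (ρ c))) ∧ ContinuousOn M (Set.Ici R₀) ∧ Tendsto M atTop (𝓝 M₀) ∧ Tendsto (fun R ↦ e.wDist (T R) d) atTop (𝓝 0)) → ∀ (G : EuclideanSpace ℝ (Fin 1) → InitialDataSet (𝓡 3) X) (δ : ℝ), (InitialDataSet.IsSmoothDataFamily 1 G ∧ G 0 = d ∧ (∀ c, G c ∈ admissibleVacuumData X) ∧ ∃ K : Set X, IsCompact K ∧ ∀ c, ∀ x ∉ K, (G c).h.inner x = d.h.inner x ∧ (G c).k x = d.k x) → 0 < δ → (∀ c : EuclideanSpace ℝ (Fin 1), 0 < c 0 → c 0 < δ → ∃ R₁ : ℝ, ∀ R : ℝ, R₀ ≤ R → R₁ ≤ R → ∀ D' ∈ admissibleVacuumData X, (∀ x ∉ e.far R, D'.h.inner x = (G c).h.inner x ∧ D'.k x = (G c).k x) → (∀ x ∈ e.far R, D'.h.inner x = (T R).h.inner x ∧ D'.k x = (T R).k x) → ∃ 𝒟 : VacuumCauchyDevelopment D',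 𝒟.IsMaximal ∧ Summit.FinalStateConjecture.FinalStateConjecture.Theorems.EIHFluxBalance.TameTemplate.HandoffClause X D' 𝒟) → ∃ ρ₁ : ℝ → ℝ, (∀ a b : ℝ, 0 < a → a ≤ b → b < δ → BddAbove (ρ₁ '' Set.Icc a b)) ∧ ∀ c : EuclideanSpace ℝ (Fin 1), 0 < c 0 → c 0 < δ → ∀ R : ℝ, R₀ ≤ R → ρ₁ (c 0) ≤ R → ∀ D' ∈ admissibleVacuumData X, (∀ x ∉ e.far R, D'.h.inner x = (G c).h.inner x ∧ D'.k x = (G c).k x) → (∀ x ∈ e.far R, D'.h.inner x = (T R).h.inner x ∧ D'.k x = (T R).k x) → ∃ 𝒟 : VacuumCauchyDevelopment D', 𝒟.IsMaximal ∧ Summit.FinalStateConjecture.FinalStateConjecture.Theorems.EIHFluxBalance.TameTemplate.HandoffClause X D' 𝒟 := by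
  sorry

/-- COMPOSITION: `CensoredKickHandoff` from K1 ⊕ K2. -/
theorem CensoredKickHandoff_of : CensoredKickHandoff := by
  intro X _ _ _ _ _ _ d hd hP G₁ δ₁ hG₁ hδ₁ hcens e M₀ R₀ T M hsole hDR hT
  obtain ⟨G, hG, δ, hδ, hpt⟩ :=
    stub_pointwiseCensoredKickHandoff X d hd hP G₁ δ₁ hG₁ hδ₁ hcens e M₀ R₀ T M hsole hDR hT
  obtain ⟨ρ₁, hbd, hgood⟩ := stub_thresholdLocallyBounded X d hd e M₀ R₀ T M hsole hDR hT G δ hG hδ hpt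
  exact ⟨G, hG, δ, ρ₁, hδ, hbd, hgood⟩

end Summit.FinalStateConjecture.FinalStateConjecture.Cruxes.ModulatedKerrHandoff.TrimKickCensorship.Births

end
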